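import Summits.QuantumFields.YangMills.Theorems.InfiniteVolumeContinuumIVEuclideanInvarianceSigned
import HarnessLib

/-!
# Infinite volume by compactness, class-parametric form IV: hyperoctahedral (signed-permutation) invariance of the
# «`L → ∞` first» continuum data along ANY torus limit states

HONEST FRAMING (cell `ym-fleet`, seat `ym-infvol-p2`, director-ym R136 (i); count-neutral helper for the route owner's
ruling on the «torus parity» junction (ym-beyond-p2 g20 2026-08-26T18:17:23Z, (c′)∕(E)); companion of
`InfiniteVolumeMomentBoundsOnSides`, `InfiniteVolumeContinuumDataOn`, `InfiniteVolumeReflectionPositivityOn`).  Pure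
soft analysis, kernel-checked; NOTHING is asserted about Yang–Mills, rotations beyond the hyperoctahedral group, a mass
gap, or Clay.

`signedPerm_invariant_of_limitStates` — the parity-free twin of seat p3's registered stub W1 `E1.stub_ivSigned`
(`InfiniteVolumeContinuumIVEuclideanInvarianceSigned`, its proof verbatim with `infiniteVolumeLimitPoints` read in place of
`oddTorusLimitPoints`, which p3's proof passes through anyway): for ANY torus limit states
`μ_k ∈ infiniteVolumeLimitPoints r.ρ (β k)` (odd or even sides; hyperoctahedrally invariant by GaugeBoot
`map_configPermZd_eq_of_mem_infiniteVolumeLimitPoints` ∕ `map_configSiteReflect_zero_eq_of_mem_infiniteVolumeLimitPoints`),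
scales `a k`, and any `(S₁, T)` with the DATA-clause structure (`S₁ 0` = evaluation, `S₁ 1 = 0`, `S₁ n = Σ_q T n q`,
centre-smeared convergence on `⁰𝒮`), `S₁` is invariant on `⁰𝒮` under every signed permutation of the axes
(p3's `sum_limit_linActMulti_coordPerm_eq`, `limit_thetaMulti_eq`, toolkit `invariant_linActMulti_of_signedPerm` BY NAME).

References: K. Osterwalder, R. Schrader, CMP 31 (1973) §3; J. Glimm, A. Jaffe, Quantum Physics (1987) §6.1.
-/

set_option autoImplicit false

noncomputable section

open scoped SchwartzMap BigOperators
open MeasureTheory Filter Topology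
open Literature.MathematicalPhysics.QuantumFieldTheory hiding ZdEdge
open Literature.MathematicalPhysics.QuantumLattice
open Literature.MathematicalPhysics.AQFT
open Literature.Probability.LatticeModels (Site)
open Summit.QuantumFields.YangMills.Cruxes.OSLegsAtWeakCouplingC.Sketch (Invariant IsSignedPerm)
open Summit.QuantumFields.YangMills.Theorems.OSLegsFromFemtoAndGap
  (coordPerm mem_planeStrings_iff invariant_linActMulti_of_signedPerm)
open Summit.QuantumFields.GaugeBoot (configSiteReflect map_configPermZd_eq_of_mem_infiniteVolumeLimitPoints
  map_configSiteReflect_zero_eq_of_mem_infiniteVolumeLimitPoints)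

namespace Summit.QuantumFields.YangMills.Theorems.InfiniteVolume

variable {G : Type} [Group G] [TopologicalSpace G] [IsTopologicalGroup G] [CompactSpace G]
  [MeasurableSpace G] [BorelSpace G]

/-- **Signed-permutation (hyperoctahedral) invariance on `⁰𝒮` along ANY torus limit states** — the parity-free twin of
seat p3's `E1.stub_ivSigned` (its proof verbatim, reading `infiniteVolumeLimitPoints` instead of `oddTorusLimitPoints`):
states `μ_k ∈ infiniteVolumeLimitPoints r.ρ (β k)`, scales `a k`, and `(S₁, T)` with `S₁ 0` = evaluation, `S₁ 1 = 0`,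
`S₁ n = Σ_{q valid} T n q` and centre-smeared convergence to `T n q` on `⁰𝒮ₙ`: then every signed permutation of the
axes fixes `S₁` on `⁰𝒮`. [folklore] -/
theorem signedPerm_invariant_of_limitStates (r : LatticeRep G) (a : ℕ → ℝ) (β : ℕ → ℝ)
    (μ : ℕ → Measure (LGConfig 4 G)) (S₁ : SchwingerFamily (EuclideanSpace ℝ (Fin 4)))
    (T : (n : ℕ) → (Fin n → Fin 4 × Fin 4) → (𝓢((Fin n → EuclideanSpace ℝ (Fin 4)), ℂ) →L[ℂ] ℂ))
    (hμ : ∀ k, μ k ∈ infiniteVolumeLimitPoints (d := 4) r.ρ (β k))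
    (h0 : ∀ F : 𝓢((Fin 0 → EuclideanSpace ℝ (Fin 4)), ℂ), S₁ 0 F = F default)
    (h1 : ∀ F : 𝓢((Fin 1 → EuclideanSpace ℝ (Fin 4)), ℂ), S₁ 1 F = 0)
    (hS : ∀ n : ℕ, 2 ≤ n → ∀ F : 𝓢((Fin n → EuclideanSpace ℝ (Fin 4)), ℂ), S₁ n F =
      ∑ q ∈ Fintype.piFinset (fun _ : Fin n => Finset.univ.filter fun p : Fin 4 × Fin 4 => p.1 < p.2), T n q F)
    (hT : ∀ n : ℕ, 2 ≤ n → ∀ q : Fin n → Fin 4 × Fin 4, (∀ i, (q i).1 < (q i).2) →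
      ∀ F : 𝓢((Fin n → EuclideanSpace ℝ (Fin 4)), ℂ), IsOffDiagonal F →
        Tendsto (fun k => ∑' x : Fin n → (Fin 4 → ℤ), ((stateMomentStr G r (μ k) n q x : ℝ) : ℂ) *
          F (fun l => a k • siteToE (x l) + (a k / 2) •
            (EuclideanSpace.single (q l).1 (1 : ℝ) + EuclideanSpace.single (q l).2 (1 : ℝ)))) atTop (𝓝 (T n q F))) :
    ∀ R : EuclideanSpace ℝ (Fin 4) ≃ₗᵢ[ℝ] EuclideanSpace ℝ (Fin 4), IsSignedPerm R → Invariant S₁ R := by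
  intro R hR n F hF
  -- a faithful continuous matrix representation of the compact group makes it Hausdorff and second countable
  haveI : T2Space G := (r.continuous.isClosedEmbedding r.injective).isEmbedding.t2Space
  haveI : SecondCountableTopology G :=
    (r.continuous.isClosedEmbedding r.injective).isEmbedding.secondCountableTopology
  -- torus limit points are hyperoctahedrally invariant (GaugeBoot), whatever the parity of the sides
  have hPπ : ∀ (k : ℕ) (π : Equiv.Perm (Fin 4)), (μ k).map (configPermZd π) = μ k := fun k π =>
    map_configPermZd_eq_of_mem_infiniteVolumeLimitPoints r.ρ r.continuous (hμ k) π
  have hΘ : ∀ k : ℕ, (μ k).map (configSiteReflect 0) = μ k := fun k =>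
    map_configSiteReflect_zero_eq_of_mem_infiniteVolumeLimitPoints r.ρ r.continuous (hμ k)
  -- coordinate permutations
  have hperm : ∀ (π : Equiv.Perm (Fin 4)) (n : ℕ) (F : 𝓢((Fin n → EuclideanSpace ℝ (Fin 4)), ℂ)),
      IsOffDiagonal F → S₁ n (linActMulti (coordPerm π) F) = S₁ n F := by
    intro π n F hF
    rcases Nat.lt_or_ge n 2 with hn | hn
    · interval_cases n
      · rw [h0, h0, linActMulti_apply]
        exact congrArg F (Subsingleton.elim _ _)
      · rw [h1, h1]
    · rw [hS n hn, hS n hn F]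
      exact sum_limit_linActMulti_coordPerm_eq r μ a hPπ (fun q F => T n q F)
        (fun q hq F hF => hT n hn q hq F hF) π F hF
  -- the time reflection
  have hθ : ∀ (n : ℕ) (F : 𝓢((Fin n → EuclideanSpace ℝ (Fin 4)), ℂ)), IsOffDiagonal F →
      S₁ n (thetaMulti 4 F) = S₁ n F := by
    intro n F hF
    rcases Nat.lt_or_ge n 2 with hn | hn
    · interval_cases n
      · rw [h0, h0, thetaMulti_apply]
        exact congrArg F (Subsingleton.elim _ _)
      · rw [h1, h1]
    · rw [hS n hn, hS n hn F]
      refine Finset.sum_congr rfl fun q hq => ?_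
      exact limit_thetaMulti_eq r μ a hΘ (fun q F => T n q F)
        (fun q hq F hF => hT n hn q hq F hF) ((mem_planeStrings_iff q).1 hq) F hF
  exact invariant_linActMulti_of_signedPerm hperm hθ R hR n F hF

end Summit.QuantumFields.YangMills.Theorems.InfiniteVolume

end
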